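import Literature.NumberTheory.EllipticCurves.ModularJacobianMultiplicityOneOfEichlerShimura
import Literature.NumberTheory.EllipticCurves.NewformGaloisRepThm61OfHeckeAlgebraRepProofs
import Literature.NumberTheory.EllipticCurves.NewformsLiftProofs
import Mathlib.FieldTheory.IsAlgClosed.Basic
import HarnessLib

/-!
# The cover `J₀(N) → J₁(N)` on torsion: the Shimura subgroup and mod `ℓ` multiplicity one for
# `J₁(N)[𝔪]` (Buzzard 2000 Lemma 2.3 ⟸ Ling–Oesterlé 1991; Buzzard's appendix to Ribet–Stein,
# Thm. 6.1 ⟸ Edixhoven 1992 Thm. 9.2) — hypothesis structure and one existence fact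

Topic `Literature/NumberTheory/EllipticCurves`, namespace of the siblings
(`Literature.NumberTheory.EllipticCurves.ModularForms`). TYPER file (D-0064: one file for one
source cluster; no `instance`, no notation).

## Why (the consumer)

The cited fact `buzzard2000_multiplicityOne_gamma0` (`ModularJacobianModTwoMultiplicityOne.lean`:
Buzzard, *On level-lowering for mod 2 representations*, Prop. 2.4 at `Γ = Γ₀(N)`, `N` odd) has been
reduced in the kernel (`ModularJacobianGaloisCharpolyRel.lean`,
`buzzard2000_multiplicityOne_gamma0_of_galoisData`) to the `ℚ`-structure of `J₀(N)` with the
Eichler–Shimura relation PLUS one residual input about a `Γ_ℚ`-datum `D : ModularJacobianGaloisData N ι`: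
"for the action `σ` of `Γ_ℚ` on `J₀(N)[𝔪]` there is a `σ`-stable `𝕋/𝔪`-subspace `U` with commuting
action and `dim (J₀(N)[𝔪] ⧸ U) ≤ 2`". In print (Buzzard 2000, p. 101, proof of Prop. 2.4, finite case:
"Choose any `M` odd, set `Γ = Γ₁(M)` (by Lemma 2.3 it suffices to treat this case) … Theorem 9.2 of
[E1]") that input is `U = J₀(N)[𝔪] ∩ Σ(N)`, `Σ(N) = ker(π^* : J₀(N) → J₁(N))` the SHIMURA SUBGROUP,
on which `Γ_ℚ` acts through an abelian quotient (Lemma 2.3 ⟸ Ling–Oesterlé), together with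
`J₀(N)[𝔪]/U ≅ π^*(J₀(N)[𝔪]) ⊆ J₁(N)[𝔪₁]`, of dimension `≤ 2` by the multiplicity-one theorem on
`J₁(N)` (Buzzard's appendix to Ribet–Stein, Thm. 6.1 — the corrected and complete form of the
`J₁`-statement, extending Edixhoven 1992 Thm. 9.2 (2)(3) and (9.2.1)). This file TYPES those
`J₁(N)`-side objects and statements; the sibling proof file
`ModularJacobianMultiplicityOneOfGammaOneCover.lean` derives the residual input from them and,
with `buzzard2000_multiplicityOne_gamma0_of_galoisData`, the cited fact from the one existence fact
below.

## Design: a hypothesis structure over the EXISTING carriers, in the tree's pattern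

Exactly as `ModularJacobianGaloisData N ι` (`AlgebraicModularParametrizationWithShift.lean`) puts the
`ℚ`-structure of `J₀(N)` ON the analytic torsion `J0.tors N = (V/Λ)_tors`, the structure
`ModularJacobianGammaOneCover N ι M₁` below EXTENDS it by the Jacobian `J₁(N)` of `X₁(N)` seen
through its torsion: the tree has the concrete Hecke ring of `S₂(Γ₁(N))`,
`heckeRing1 N 2 = ℤ[T_p (p prime), ⟨d⟩ (d ∈ (ℤ/N)ˣ)] ⊆ End_ℂ S₂(Γ₁(N))` (`DeligneSerreSpanHeckeDualityProofs`,
generators `heckeRing1.T`, `heckeRing1.diamond`), but NO analytic `J₁(N)` (no period homology for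
`Γ₁(N)`; `cuspSymbol`/`periodHomology` are `Γ₀(N)`-only), so the `heckeRing1 N 2`-module
`M₁ = J₁(N)(ℚ̄)_tors` is a PARAMETER (type + instances), and the data are: the Galois action
`galAct₁` on it by Hecke-linear automorphisms; the Picard pull-back `pullback = π^*` on torsion
along `π : X₁(N) → X₀(N)`; and the AXIOMS, each a printed statement with its locator:
`galAct_eichlerShimura` (the Eichler–Shimura relation for the underlying `galAct`, verbatim the
clause of the sibling fact `nonempty_modularJacobianGaloisData_eichlerShimura` — carried here because
the cover must sit over the SAME Galois action), `pullback_galAct` (π^* is a `ℚ`-morphism),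
`pullback_smul` (Hecke-compatibility of `π^*` through the restriction homomorphism
`restrictHecke N 2 : 𝕋(Γ₁(N)) → 𝕋(Γ₀(N)) = HeckeRing0 N 2`, `T_p ↦ T_p`, `⟨d⟩ ↦ 1`, which is DEFINED
and its properties PROVED in this file from the tree's `heckeT_liftToGamma1`,
`diamondOp_liftToGamma1`, `coe_liftToGamma1_holds`),
`galAct_comm_of_pullback_eq_zero` (Buzzard's Lemma 2.3: `Γ_ℚ` acts on `ker π^*` through an abelian
quotient), `finrank_torsionBySet_eq_two₁` (appendix Thm. 6.1 at weight `k = 2`, every `ℓ ∤ N`).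
ONE named fact `nonempty_modularJacobianGammaOneCover` asserts existence for all `N ≥ 1`, `ι`.

Faithfulness notes. (1) Thm. 6.1 is typed WEAKER-OR-EQUAL to print: its hypothesis "`ρ_f`
unramified at `ℓ` but `ρ_f(Frob_ℓ)` not scalar" is rendered "every arithmetic Frobenius at every
`𝔓 ∣ ℓ` is non-scalar" (equivalent in the unramified case, where these are conjugate modulo the
trivially-acting inertia); "`f` a normalised eigenform of level `N`, weight `2`, over `𝔽̄_ℓ`,
`𝔪` its maximal ideal of `H`, `F = H/𝔪 ↪ 𝔽̄_ℓ`" is rendered, as in the tree's `wiles1995_multiplicityOne`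
and `buzzard2000_multiplicityOne_gamma0`, by "`𝔪 ∋ ℓ` a maximal ideal of `H = heckeRing1 N 2`,
`ι' : H/𝔪 →+* k`, `k` algebraically closed"; "`ρ_f` absolutely irreducible" by `FramedRep.IsIrreducible`
over the algebraically closed `k`; "`ρ_f` associated to `f`" by the Frobenius characteristic polynomials
`X² - ι'(T_p) X + p ι'(⟨p⟩)` at `p ∤ Nℓ` (arithmetic Frobenius; the volume's normalisation, Conrad's
appendix Thm. 5.12, = the tree's `frobPoly`); at `k = 2` one has `N* = N` and the proviso "if
`k = ℓ + 1` …" is void. (2) Lemma 2.3 is printed as "acts via an abelian quotient"; typed as the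
equivalent "any two elements of `Γ_ℚ` commute on `ker π^*`". (3) `M₁` is "the" torsion of
`J₁(N)(ℚ̄)`: recorded by `isOfFinAddOrder₁`; `J_ℚ(ℚ̄)[𝔪]` of print is `M₁[𝔪]` since `𝔪 ∋ ℓ`.
(4) Nothing here is specific to `ℓ = 2`. (5) Picard versus Albanese: `pullback_smul` forces `M₁` to carry the
Hecke action compatible with the tree's action on `J0 N` (transpose of the action on cusp forms,
i.e. Albanese functoriality `h ↦ h_*`), whereas Buzzard's `H ⊂ End(J_ℚ)` acts "via Picard
functoriality" `h ↦ h^*`; the Atkin–Lehner automorphism `w_ζ` of `J₁(N)` (over `ℚ(ζ_N)`) satisfies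
`w h_* w⁻¹ = (h_*)† = h^*` (Rosati = Petersson adjoint; Diamond–Shurman Thm. 5.5.3), so it carries
the `𝔪`-torsion for one action `H/𝔪`-linearly onto the `𝔪`-torsion for the other: the DIMENSION
statement of Thm. 6.1 is the same for both (the same remark as in the docstrings of
`buzzard2000_multiplicityOne_gamma0` and `wiles1995_multiplicityOne` for `J0 N`).

## What is NOT here

No analytic or scheme-theoretic `J₁(N)`, no finite flat group schemes / Néron models over `ℤ_ℓ`
(the printed PROOF of Thm. 6.1: Gross §§11–12, Fontaine, Oda, Mazur §II.14 — a theory the tree does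
not have; hence a named fact), no structure theorem for `Σ(N)` (Ling–Oesterlé Thm. 1, Cor. 1: order,
`μ`-type) beyond the abelian action, no Eichler–Shimura relation (the sibling fact of
`ModularJacobianGaloisDataExists.lean` / `ModularJacobianGaloisCharpolyRel.lean` supplies it), no
uniqueness of any of the data. Nothing here proves `buzzard2000_multiplicityOne_gamma0` or any
summit statement.

## References

* [Buzzard2000LevelLoweringModTwo] K. Buzzard, *On level-lowering for mod 2 representations*,
  Math. Res. Lett. 7 (2000) 95–110: Lemma 2.3 and proof of Prop. 2.4 (p. 101) (held text
  `paper:doi-10-4310-mrl-2000-v7-n1-a9`, p0007).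
* [RibetStein2008] K. Ribet, W. Stein, *Lectures on Serre's conjectures*; Ch. 6 = Appendix by
  K. Buzzard, *A mod `ℓ` multiplicity one result*, Thm. 6.1 and its setup (pp. 81–82; held text
  `paper:doi-10-1090-pcms-009-04`, p0084–p0085).
* [Edixhoven1992] B. Edixhoven, *The weight in Serre's conjectures on modular forms*, Invent. Math.
  109 (1992) 563–594, Thm. 9.2 (not held: acq-02558, cite-only; locator from Buzzard's citations).
* [LingOesterle1991] S. Ling, J. Oesterlé, *The Shimura subgroup of `J₀(N)`*, Astérisque 196–197
  (1991) 171–203, §4.2 and Prop. 6 (as cited by Buzzard, Lemma 2.3); Thm. 6.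
* [Vatsal2005] V. Vatsal, *Multiplicative subgroups of `J₀(N)` and applications to elliptic curves*,
  J. Inst. Math. Jussieu 4 (2005), §1 p. 281 (held text `paper:doi-10-1017-s147474800500006x`, p0001:
  "`π^* : J₀(N) → J₁(N)` … The kernel of `π^*` is a finite subgroup `V` of `J₀(N)(ℚ̄)`, known as the
  Shimura subgroup. Since `π^*` is a `ℚ`-rational map, the subgroup `V` is stable under the action of
  `Gal(ℚ̄/ℚ)`. It is known that `V` is of multiplicative type … [LO91]").
* [DarmonDiamondTaylor1995] H. Darmon, F. Diamond, R. Taylor, *Fermat's Last Theorem*, §1.5 p. 36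
  (models of `X₁(N)`, `J₁(N)` over `ℚ`; Hecke correspondences and diamond operators defined over `ℚ`).
* [Conrad2001ShimuraConstruction] B. Conrad, *The Shimura construction in weight 2* (appendix to
  [RibetStein2008]), §5.5.1, Thm. 5.12 (normalisation `X² - T_p X + p⟨p⟩`, arithmetic Frobenius).
* [DiamondShurman2005] F. Diamond, J. Shurman, *A First Course in Modular Forms*, §5.2 (`T_p` on
  `Γ₀(N)` and `Γ₁(N)` by the same double coset; `⟨d⟩ = 1` on `S_k(Γ₀(N))`), §6.2 (Picard / Albanese
  functoriality of `J₀(N)`, `J₁(N)`).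
-/

noncomputable section

open scoped MatrixGroups ModularForm NumberField

open CongruenceSubgroup Polynomial IsDedekindDomain

namespace Literature.NumberTheory.EllipticCurves.ModularForms

open GaloisRepresentations Rat.HeightOneSpectrum

/-! ### The restriction of the Hecke ring of `Γ₁(N)` to the old part `S_k(Γ₀(N))` (defined, proved) -/

section Restrict

variable (N : ℕ) [NeZero N] (k : ℤ)

/-- Every element `h` of the Hecke ring `ℤ[T_p, ⟨d⟩]` of `S_k(Γ₁(N))` preserves the old part
`S_k(Γ₀(N)) ⊂ S_k(Γ₁(N))` (the image of `liftToGamma1`) and acts there by an element of the Hecke ring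
`𝕋_ℤ(Γ₀(N))`: on generators `T_p ↦ T_p` (`heckeT_liftToGamma1`: the same double coset
`Γ diag(1,p) Γ`) and `⟨d⟩ ↦ 1` (`diamondOp_liftToGamma1`); closed under the ring operations.
(Diamond–Shurman §5.2: `T_p` and `⟨d⟩` on `M_k(Γ₁(N)) ⊇ M_k(Γ₀(N))`.) [cite: DiamondShurman2005, §5.2] -/
theorem exists_mem_heckeRing0_comp_liftToGamma1 {h : Module.End ℂ (CuspForm (Gamma1 N) k)}
    (hh : h ∈ heckeRing1 N k) :
    ∃ t : Module.End ℂ (CuspForm (Gamma0 N) k), t ∈ heckeRing0 N k ∧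
      h ∘ₗ liftToGamma1 N k = liftToGamma1 N k ∘ₗ t := by
  induction hh using Algebra.adjoin_induction with
  | mem h hh =>
    rcases hh with ⟨p, hp, rfl⟩ | ⟨d, rfl⟩
    · haveI : NeZero p := ⟨hp.ne_zero⟩
      exact ⟨heckeT (Gamma0 N) k p, heckeRing0.heckeT_mem N k p hp,
        LinearMap.ext fun f => heckeT_liftToGamma1 N k p f⟩
    · exact ⟨1, one_mem _, LinearMap.ext fun f => by simp [diamondOp_liftToGamma1 N k]⟩
  | algebraMap r =>
    refine ⟨algebraMap ℤ _ r, algebraMap_mem _ r, LinearMap.ext fun f => ?_⟩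
    simp
  | add h h' _ _ ih ih' =>
    obtain ⟨t, ht, e⟩ := ih
    obtain ⟨t', ht', e'⟩ := ih'
    exact ⟨t + t', add_mem ht ht', by rw [LinearMap.add_comp, LinearMap.comp_add, e, e']⟩
  | mul h h' _ _ ih ih' =>
    obtain ⟨t, ht, e⟩ := ih
    obtain ⟨t', ht', e'⟩ := ih'
    refine ⟨t * t', mul_mem ht ht', ?_⟩
    rw [Module.End.mul_eq_comp, Module.End.mul_eq_comp, LinearMap.comp_assoc, e',
      ← LinearMap.comp_assoc, e, LinearMap.comp_assoc]

/-- Uniqueness of the restriction: `liftToGamma1` is injective (it does not change the underlying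
function, `coe_liftToGamma1_holds`), so `lift ∘ t = lift ∘ t'` forces `t = t'` (Diamond–Shurman
§5.1, p. 166, case (1): `M_k(Γ₀(N)) ⊆ M_k(Γ₁(N))`). [cite: DiamondShurman2005, §5.1 (p. 166) case (1)] -/
theorem eq_of_liftToGamma1_comp_eq {t t' : Module.End ℂ (CuspForm (Gamma0 N) k)}
    (h : liftToGamma1 N k ∘ₗ t = liftToGamma1 N k ∘ₗ t') : t = t' := by
  refine LinearMap.ext fun f => ?_
  have hf := LinearMap.congr_fun h f
  simp only [LinearMap.coe_comp, Function.comp_apply] at hf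
  apply DFunLike.coe_injective
  rw [← coe_liftToGamma1_holds N k (t f), ← coe_liftToGamma1_holds N k (t' f), hf]

/-- The restriction of `h ∈ ℤ[T_p, ⟨d⟩]` to the old part, as an endomorphism of `S_k(Γ₀(N))`
(auxiliary; a choice from `exists_mem_heckeRing0_comp_liftToGamma1`, unique by
`eq_of_liftToGamma1_comp_eq`). [cite: DiamondShurman2005, §5.2] -/
def restrictHeckeEnd (h : heckeRing1 N k) : Module.End ℂ (CuspForm (Gamma0 N) k) :=
  (exists_mem_heckeRing0_comp_liftToGamma1 N k h.2).choose

/-- `restrictHeckeEnd h` lies in `𝕋_ℤ(Γ₀(N))`. [cite: DiamondShurman2005, §5.2] -/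
theorem restrictHeckeEnd_mem (h : heckeRing1 N k) : restrictHeckeEnd N k h ∈ heckeRing0 N k :=
  (exists_mem_heckeRing0_comp_liftToGamma1 N k h.2).choose_spec.1

/-- Defining relation of `restrictHeckeEnd`: `h ∘ lift = lift ∘ restrictHeckeEnd h`.
[cite: DiamondShurman2005, §5.2] -/
theorem comp_liftToGamma1_eq_restrictHeckeEnd (h : heckeRing1 N k) :
    (h : Module.End ℂ (CuspForm (Gamma1 N) k)) ∘ₗ liftToGamma1 N k =
      liftToGamma1 N k ∘ₗ restrictHeckeEnd N k h :=
  (exists_mem_heckeRing0_comp_liftToGamma1 N k h.2).choose_spec.2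

/-- `restrictHeckeEnd` is multiplicative. [cite: DiamondShurman2005, §5.2] -/
theorem restrictHeckeEnd_mul (h h' : heckeRing1 N k) :
    restrictHeckeEnd N k (h * h') = restrictHeckeEnd N k h * restrictHeckeEnd N k h' := by
  refine eq_of_liftToGamma1_comp_eq N k ?_
  rw [← comp_liftToGamma1_eq_restrictHeckeEnd, Subalgebra.coe_mul, Module.End.mul_eq_comp,
    Module.End.mul_eq_comp, LinearMap.comp_assoc, comp_liftToGamma1_eq_restrictHeckeEnd N k h',
    ← LinearMap.comp_assoc, comp_liftToGamma1_eq_restrictHeckeEnd N k h, LinearMap.comp_assoc]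

/-- `restrictHeckeEnd` is additive. [cite: DiamondShurman2005, §5.2] -/
theorem restrictHeckeEnd_add (h h' : heckeRing1 N k) :
    restrictHeckeEnd N k (h + h') = restrictHeckeEnd N k h + restrictHeckeEnd N k h' := by
  refine eq_of_liftToGamma1_comp_eq N k ?_
  rw [← comp_liftToGamma1_eq_restrictHeckeEnd, Subalgebra.coe_add, LinearMap.add_comp,
    LinearMap.comp_add, comp_liftToGamma1_eq_restrictHeckeEnd N k h,
    comp_liftToGamma1_eq_restrictHeckeEnd N k h']

/-- `restrictHeckeEnd 1 = 1`. [cite: DiamondShurman2005, §5.2] -/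
theorem restrictHeckeEnd_one : restrictHeckeEnd N k 1 = 1 := by
  refine eq_of_liftToGamma1_comp_eq N k ?_
  rw [← comp_liftToGamma1_eq_restrictHeckeEnd, OneMemClass.coe_one, Module.End.one_eq_id,
    LinearMap.id_comp, Module.End.one_eq_id, LinearMap.comp_id]

/-- `restrictHeckeEnd 0 = 0`. [cite: DiamondShurman2005, §5.2] -/
theorem restrictHeckeEnd_zero : restrictHeckeEnd N k 0 = 0 := by
  refine eq_of_liftToGamma1_comp_eq N k ?_
  rw [← comp_liftToGamma1_eq_restrictHeckeEnd, ZeroMemClass.coe_zero, LinearMap.zero_comp,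
    LinearMap.comp_zero]

/-- **The restriction homomorphism `ℤ[T_p, ⟨d⟩] = 𝕋_ℤ(Γ₁(N)) → 𝕋_ℤ(Γ₀(N)) = HeckeRing0 N k`**: the
action of the Hecke ring of `S_k(Γ₁(N))` on the old part `S_k(Γ₀(N))` (well defined and a ring
homomorphism by `exists_mem_heckeRing0_comp_liftToGamma1` and `eq_of_liftToGamma1_comp_eq`);
`T_p ↦ T_p`, `⟨d⟩ ↦ 1` (`restrictHecke_T`, `restrictHecke_diamond`), onto (`restrictHecke_surjective`).
(Diamond–Shurman §5.2.) [cite: DiamondShurman2005, §5.2] -/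
def restrictHecke : heckeRing1 N k →+* HeckeRing0 N k where
  toFun h := (HeckeRing0.toSubalgebra N k).symm ⟨restrictHeckeEnd N k h, restrictHeckeEnd_mem N k h⟩
  map_one' := (HeckeRing0.toSubalgebra N k).injective <| by
    rw [RingEquiv.apply_symm_apply, map_one]
    exact Subtype.ext (restrictHeckeEnd_one N k)
  map_mul' h h' := (HeckeRing0.toSubalgebra N k).injective <| by
    rw [RingEquiv.apply_symm_apply, map_mul, RingEquiv.apply_symm_apply, RingEquiv.apply_symm_apply]
    exact Subtype.ext (restrictHeckeEnd_mul N k h h')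
  map_zero' := (HeckeRing0.toSubalgebra N k).injective <| by
    rw [RingEquiv.apply_symm_apply, map_zero]
    exact Subtype.ext (restrictHeckeEnd_zero N k)
  map_add' h h' := (HeckeRing0.toSubalgebra N k).injective <| by
    rw [RingEquiv.apply_symm_apply, map_add, RingEquiv.apply_symm_apply, RingEquiv.apply_symm_apply]
    exact Subtype.ext (restrictHeckeEnd_add N k h h')

/-- `toEnd (restrictHecke h) = restrictHeckeEnd h`. [cite: DiamondShurman2005, §5.2] -/
@[simp] theorem toEnd_restrictHecke (h : heckeRing1 N k) :
    HeckeRing0.toEnd N k (restrictHecke N k h) = restrictHeckeEnd N k h :=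
  rfl

/-- Defining property of `restrictHecke`: `h ∘ lift = lift ∘ restrictHecke h` on `S_k(Γ₀(N))`
(through `HeckeRing0.toEnd`). [cite: DiamondShurman2005, §5.2] -/
theorem comp_liftToGamma1_eq_restrictHecke (h : heckeRing1 N k) :
    (h : Module.End ℂ (CuspForm (Gamma1 N) k)) ∘ₗ liftToGamma1 N k =
      liftToGamma1 N k ∘ₗ HeckeRing0.toEnd N k (restrictHecke N k h) :=
  comp_liftToGamma1_eq_restrictHeckeEnd N k h

/-- `restrictHecke` is characterised by the intertwining relation: if `h ∘ lift = lift ∘ t` with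
`t ∈ 𝕋_ℤ(Γ₀(N))` then `restrictHecke h = t`. [cite: DiamondShurman2005, §5.2] -/
theorem restrictHecke_eq_of_comp_eq (h : heckeRing1 N k) (t : HeckeRing0 N k)
    (ht : (h : Module.End ℂ (CuspForm (Gamma1 N) k)) ∘ₗ liftToGamma1 N k =
      liftToGamma1 N k ∘ₗ HeckeRing0.toEnd N k t) :
    restrictHecke N k h = t := by
  apply HeckeRing0.toEnd_injective N k
  exact eq_of_liftToGamma1_comp_eq N k ((comp_liftToGamma1_eq_restrictHecke N k h).symm.trans ht)

/-- `restrictHecke (T_p) = T_p` for every prime `p` (`U_p ↦ U_p` for `p ∣ N`): tree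
`heckeT_liftToGamma1`. [cite: DiamondShurman2005, §5.2] -/
@[simp] theorem restrictHecke_T (q : Nat.Primes) :
    restrictHecke N k (heckeRing1.T N k q) = HeckeRing0.T N k (q : ℕ) q.2 := by
  refine restrictHecke_eq_of_comp_eq N k _ _ (LinearMap.ext fun f => ?_)
  haveI : NeZero (q : ℕ) := ⟨q.2.ne_zero⟩
  rw [HeckeRing0.toEnd_T]
  exact heckeT_liftToGamma1 N k (q : ℕ) f

/-- `restrictHecke ⟨d⟩ = 1`: the diamond operators act trivially on `S_k(Γ₀(N))` (tree
`diamondOp_liftToGamma1`). [cite: DiamondShurman2005, §5.2] -/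
@[simp] theorem restrictHecke_diamond (d : ZMod N) :
    restrictHecke N k (heckeRing1.diamond N k d) = 1 := by
  refine restrictHecke_eq_of_comp_eq N k _ _ (LinearMap.ext fun f => ?_)
  rw [map_one]
  exact diamondOp_liftToGamma1 N k d f

/-- `restrictHecke` is surjective: its image is a subring of `𝕋_ℤ(Γ₀(N)) = ℤ[T_p : p prime]`
containing every `T_p` (generation: `heckeRing0_eq_adjoin`). [cite: DarmonDiamondTaylor1995, §4.1 Lemma 4.1 (a) (p. 107)] -/
theorem restrictHecke_surjective : Function.Surjective (restrictHecke N k) := by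
  intro t
  suffices h : ∀ (T : Module.End ℂ (CuspForm (Gamma0 N) k)), T ∈ heckeRing0 N k →
      ∃ h : heckeRing1 N k, HeckeRing0.toEnd N k (restrictHecke N k h) = T by
    obtain ⟨h, hh⟩ := h _ (HeckeRing0.toEnd_mem N k t)
    exact ⟨h, HeckeRing0.toEnd_injective N k hh⟩
  intro T hT
  induction hT using Algebra.adjoin_induction with
  | mem T hT =>
    obtain ⟨p, hp, rfl⟩ := hT
    exact ⟨heckeRing1.T N k ⟨p, hp⟩, by rw [restrictHecke_T, HeckeRing0.toEnd_T]⟩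
  | algebraMap r =>
    refine ⟨algebraMap ℤ (heckeRing1 N k) r, ?_⟩
    rw [eq_intCast, map_intCast, map_intCast, eq_intCast]
  | add S T _ _ ihS ihT =>
    obtain ⟨a, ha⟩ := ihS
    obtain ⟨b, hb⟩ := ihT
    exact ⟨a + b, by rw [map_add, map_add, ha, hb]⟩
  | mul S T _ _ ihS ihT =>
    obtain ⟨a, ha⟩ := ihS
    obtain ⟨b, hb⟩ := ihT
    exact ⟨a * b, by rw [map_mul, map_mul, ha, hb]⟩

end Restrict

/-! ### The hypothesis structure -/

section Structure

variable (N : ℕ) [NeZero N] (ι : AlgebraicClosure ℚ →+* ℂ)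
  (M₁ : Type) [AddCommGroup M₁] [Module (heckeRing1 N 2) M₁]

/-- **The cover `π : X₁(N) → X₀(N)` on the torsion of the Jacobians, with the Shimura subgroup and
mod `ℓ` multiplicity one for `J₁(N)`** (hypothesis structure extending `ModularJacobianGaloisData N ι`;
existence is the named fact `nonempty_modularJacobianGammaOneCover`). The PARAMETER `M₁` is the
torsion subgroup `J₁(N)(ℚ̄)_tors` of the Jacobian of `X₁(N)` over `ℚ` (Darmon–Diamond–Taylor §1.5,
p. 36: "`J_Γ`, `J₀(N)` and `J₁(N)` … abelian varieties defined over `ℚ`") as a module over the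
tree's Hecke ring `heckeRing1 N 2 = ℤ[T_p, ⟨d⟩]` of `S₂(Γ₁(N))` ("`T_n` arises from a correspondence
which is defined over `ℚ`, and gives rise to an endomorphism of the Jacobian `J_Γ` which is defined
over `ℚ`", loc. cit.; the diamond operators likewise). DATA: `galAct₁`, the action of `Γ_ℚ` on `M₁`
transported along `ι`, by Hecke-linear automorphisms; `pullback`, the Picard pull-back
`π^* : J₀(N)(ℚ̄)_tors → J₁(N)(ℚ̄)_tors` (Vatsal 2005 §1: "By Picard functoriality, we deduce a
morphism of Jacobians `π^* : J₀(N) → J₁(N)`"); `restrictHecke`, the restriction of the Hecke ring of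
`Γ₁(N)` to the old part `S₂(Γ₀(N)) ⊂ S₂(Γ₁(N))` (`T_p ↦ T_p`, `⟨d⟩ ↦ 1`; Diamond–Shurman §5.2).
AXIOMS: the Eichler–Shimura relation for `galAct` on prime-to-`p` torsion (verbatim the clause of
`nonempty_modularJacobianGaloisData_eichlerShimura`; Darmon–Diamond–Taylor Thm. 1.29); open stabilisers
and finite orders on `M₁`; `π^*` is `Γ_ℚ`-equivariant ("Since `π^*` is a `ℚ`-rational map", Vatsal
loc. cit.) and Hecke-compatible through `restrictHecke N 2`; Buzzard 2000 Lemma 2.3 (`Γ_ℚ` acts on `ker π^*`, the Shimura subgroup, through an abelian quotient;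
⟸ Ling–Oesterlé 1991 Prop. 6, §4.2); and Buzzard's appendix to Ribet–Stein, Thm. 6.1 at weight `2`
(`dim_{H/𝔪} J₁(N)(ℚ̄)[𝔪] = 2`). See the module docstring for the faithfulness notes.
[cite: Buzzard2000LevelLoweringModTwo, Lemma 2.3 and proof of Prop. 2.4 (p. 101)]
[cite: RibetStein2008, Appendix (K. Buzzard), Thm. 6.1 (pp. 81–82)]
[cite: Vatsal2005, §1 (p. 281)] [cite: DarmonDiamondTaylor1995, §1.5 (p. 36) and Thm. 1.29 (p. 37)] -/
structure ModularJacobianGammaOneCover extends ModularJacobianGaloisData N ι where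
  /-- **Eichler–Shimura congruence relation, Galois form, for THIS datum's action on `J₀(N)_tors`**
  (verbatim the clause of the sibling fact `nonempty_modularJacobianGaloisData_eichlerShimura`,
  `ModularJacobianMultiplicityOneOfEichlerShimura.lean`; Darmon–Diamond–Taylor Thm. 1.29, p. 37, with
  the proof of Thm. 3.1(a), p. 86): for every prime `p ∤ N`, prime `𝔓 ∣ p` of `\bar ℤ`, arithmetic
  Frobenius `φ` at `𝔓` and torsion point `x` of order prime to `p`, `φ(φ x) - T_p (φ x) + p x = 0`.
  Carried as a field (not a separate fact) because the `J₁(N)`-cover below must sit over the SAME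
  Galois action as the Eichler–Shimura relation for the two to be used together. -/
  galAct_eichlerShimura : ∀ v : HeightOneSpectrum (𝓞 ℚ), ¬ ((primesEquiv v : Nat.Primes) : ℕ) ∣ N →
    ∀ 𝔓 ∈ v.primesAbove, ∀ φ : Field.absoluteGaloisGroup ℚ, IsArithFrobAt (𝓞 ℚ) φ 𝔓 →
    ∀ m : ℕ, ¬ ((primesEquiv v : Nat.Primes) : ℕ) ∣ m →
    ∀ x : J0.tors N, (m : HeckeRing0 N 2) • x = 0 →
      galAct φ (galAct φ x)
        - (HeckeRing0.T N 2 ((primesEquiv v : Nat.Primes) : ℕ) (primesEquiv v : Nat.Primes).2)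
            • galAct φ x
        + (((primesEquiv v : Nat.Primes) : ℕ) : HeckeRing0 N 2) • x = 0
  /-- The action of `Γ_ℚ` on `M₁ = J₁(N)(ℚ̄)_tors` (transported along `ι`), by automorphisms
  commuting with the Hecke ring `ℤ[T_p, ⟨d⟩]` (the Hecke correspondences and diamond operators are
  defined over `ℚ`). -/
  galAct₁ : Field.absoluteGaloisGroup ℚ →* (M₁ ≃ₗ[heckeRing1 N 2] M₁)
  /-- Point stabilisers are open (torsion points of `J₁(N)` are defined over number fields). -/
  isOpen_stabilizer₁ : ∀ y : M₁, IsOpen {σ : Field.absoluteGaloisGroup ℚ | galAct₁ σ y = y}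
  /-- `M₁` is a torsion group (it is the torsion subgroup of `J₁(N)(ℚ̄)`). -/
  isOfFinAddOrder₁ : ∀ y : M₁, IsOfFinAddOrder y
  /-- The Picard pull-back `π^* : J₀(N)(ℚ̄)_tors → J₁(N)(ℚ̄)_tors` along `π : X₁(N) → X₀(N)`,
  on the analytic torsion `J0.tors N = (V/Λ)_tors` of the tree's `J0 N`. -/
  pullback : J0.tors N →+ M₁
  /-- `π^*` is defined over `ℚ`: it commutes with the Galois actions. -/
  pullback_galAct : ∀ (σ : Field.absoluteGaloisGroup ℚ) (x : J0.tors N),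
    pullback (galAct σ x) = galAct₁ σ (pullback x)
  /-- Hecke-compatibility of `π^*`: for `h ∈ ℤ[T_p, ⟨d⟩]`, `π^* ∘ h|_{J₀(N)} = h ∘ π^*`, where `h`
  acts on `J₀(N)` through the (defined) restriction `restrictHecke N 2 : 𝕋_ℤ(Γ₁(N)) → 𝕋_ℤ(Γ₀(N))`
  (both Jacobians with the Hecke action induced from the action on cusp forms, as for the tree's
  `J0 N`; `π^*` is the transpose of the trace `S₂(Γ₁(N)) → S₂(Γ₀(N))`, which commutes with every
  `T_p` and is `⟨d⟩`-invariant). -/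
  pullback_smul : ∀ (h : heckeRing1 N 2) (x : J0.tors N),
    pullback (restrictHecke N 2 h • x) = h • pullback x
  /-- **Buzzard 2000, Lemma 2.3** ("If `Γ₁(M) ⊆ Γ ⊆ Γ₀(M)` then `Gal(ℚ̄/ℚ)` acts on the kernel of
  the natural map `J(Γ) → J₁(M)` via an abelian quotient"; proof: "an immediate consequence of
  Proposition 6 of [LO] (and the discussion in §4.2 of [LO])"), at `Γ = Γ₀(N)`: any two elements of
  `Γ_ℚ` commute on `ker π^* = Σ(N)`, the Shimura subgroup (of multiplicative type, Vatsal 2005 §1). -/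
  galAct_comm_of_pullback_eq_zero : ∀ (σ τ : Field.absoluteGaloisGroup ℚ) (x : J0.tors N),
    pullback x = 0 → galAct σ (galAct τ x) = galAct τ (galAct σ x)
  /-- **Buzzard's appendix to Ribet–Stein, Thm. 6.1, weight `k = 2`** (so `N* = N`, `J_ℚ = J₁(N)`,
  `H = ℤ[T_p (all p), ⟨d⟩] = heckeRing1 N 2`): for a prime `ℓ ∤ N`, a maximal ideal `𝔪 ∋ ℓ` of `H`
  (the maximal ideal of a weight-`2` level-`N` eigenform `f` over `𝔽̄_ℓ`), `ι' : H/𝔪 → k`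
  algebraically closed, and `ρ = ρ_f : Γ_ℚ → GL₂(k)` — unramified at `p ∤ Nℓ` with
  `charpoly ρ(Frob_p) = X² - ι'(T_p) X + p ι'(⟨p⟩)` — absolutely irreducible, and such that `ρ` is
  ramified at `ℓ`, or (unramified and) every arithmetic Frobenius at `ℓ` is a non-scalar matrix:
  "`J_ℚ(ℚ̄)[𝔪]` has `H/𝔪`-dimension two" (read for the Hecke action of `M₁`, which differs from
  Buzzard's Picard normalisation by the Atkin–Lehner automorphism `w_ζ`, not in dimension — module
  docstring, note (5)). -/
  finrank_torsionBySet_eq_two₁ : ∀ (ℓ : ℕ), ℓ.Prime → ¬ ℓ ∣ N →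
    ∀ (𝔪 : Ideal (heckeRing1 N 2)), 𝔪.IsMaximal → ((ℓ : ℕ) : heckeRing1 N 2) ∈ 𝔪 →
    ∀ (k : Type) [Field k] [IsAlgClosed k] [TopologicalSpace k] [DiscreteTopology k]
      (ι' : heckeRing1 N 2 ⧸ 𝔪 →+* k) (ρ : ModPGaloisRep ℚ k 2),
      (∀ v : HeightOneSpectrum (𝓞 ℚ), ¬ ((primesEquiv v : Nat.Primes) : ℕ) ∣ N * ℓ →
        ρ.IsUnramifiedAt v ∧
          ρ.HasFrobCharpolyAt v
            (X ^ 2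
              - C (ι' (Ideal.Quotient.mk 𝔪 (heckeRing1.T N 2 (primesEquiv v)))) * X
              + C ((((primesEquiv v : Nat.Primes) : ℕ) : k) *
                  ι' (Ideal.Quotient.mk 𝔪
                    (heckeRing1.diamond N 2 ((((primesEquiv v : Nat.Primes) : ℕ) : ZMod N))))))) →
      FramedRep.IsIrreducible ρ →
      (∀ v : HeightOneSpectrum (𝓞 ℚ), ((primesEquiv v : Nat.Primes) : ℕ) = ℓ →
        (¬ ρ.IsUnramifiedAt v) ∨
          ∀ 𝔓 ∈ v.primesAbove, ∀ φ : Field.absoluteGaloisGroup ℚ, IsArithFrobAt (𝓞 ℚ) φ 𝔓 →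
            ∀ c : k, ((ρ φ : GL (Fin 2) k) : Matrix (Fin 2) (Fin 2) k) ≠ Matrix.scalar (Fin 2) c) →
      Module.finrank (heckeRing1 N 2 ⧸ 𝔪) (Submodule.torsionBySet (heckeRing1 N 2) M₁ 𝔪) = 2

end Structure

/-! ### The named fact: existence of the data -/

section Fact

/-- **Existence of the cover data `J₀(N) → J₁(N)` on torsion, every level** (named fact;
provenance clause by clause). For every `N ≥ 1` and every embedding `ι : ℚ̄ → ℂ` there are a
`heckeRing1 N 2`-module `M₁` and data `ModularJacobianGammaOneCover N ι M₁`. Witness: `M₁ =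
J₁(N)(ℚ̄)_tors` with `ℤ[T_p, ⟨d⟩]` acting through the endomorphisms of `J₁(N)` induced by the Hecke
correspondences and diamond automorphisms (Darmon–Diamond–Taylor §1.5 p. 36: `J₁(N)` is an abelian
variety over `ℚ`, the `T_n` and `⟨d⟩` are defined over `ℚ`) — whence `galAct₁` (Hecke-linear),
`isOpen_stabilizer₁` (torsion points are algebraic), `isOfFinAddOrder₁`; the first three fields
(`toModularJacobianGaloisData`) and `galAct_eichlerShimura` EXACTLY as in the sibling fact
`nonempty_modularJacobianGaloisData_eichlerShimura` (Darmon–Diamond–Taylor §1.5 p. 36, Thm. 1.29 p. 37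
with the proof of Thm. 3.1(a) p. 86; Shimura Thm. 7.9), which this fact therefore implies
(`nonempty_modularJacobianGaloisData_eichlerShimura_of_gammaOneCover`);
`pullback = π^*` by Picard functoriality along `π : X₁(N) → X₀(N)`, `ℚ`-rational, hence
`pullback_galAct` (Vatsal 2005 §1 p. 281); `restrictHecke`, `restrictHecke_T`, `restrictHecke_diamond`,
`pullback_smul`: the Hecke ring of `Γ₁(N)` preserves the old part `S₂(Γ₀(N))` and acts there by
`T_p ↦ T_p`, `⟨d⟩ ↦ 1` (Diamond–Shurman §5.2; tree `heckeT_liftToGamma1`, `diamondOp_liftToGamma1`),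
and `π^*` (transpose of the trace `S₂(Γ₁(N)) → S₂(Γ₀(N))`, which commutes with the `T_p` and is
`⟨d⟩`-invariant) intertwines the two actions (op. cit. §6.2); `galAct_comm_of_pullback_eq_zero`:
Buzzard 2000 Lemma 2.3 (⟸ Ling–Oesterlé 1991 Prop. 6 and §4.2: `ker π^* = Σ(N)` is of
multiplicative type, so `Γ_ℚ` acts on it through `Gal(ℚ(μ_∞)/ℚ)`); `finrank_torsionBySet_eq_two₁`:
Buzzard's appendix to Ribet–Stein, Thm. 6.1 at `k = 2` (⟸ Edixhoven 1992 Thm. 9.2 (2)(3) and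
(9.2.1); Mazur 1977 §II.14; Gross §§11–12), with `ρ_f ↔ ρ` through the Frobenius polynomials
`X² - T_p X + p⟨p⟩` (Conrad's appendix, Thm. 5.12). Not proved here (no `X₁(N)`, `J₁(N)` over `ℚ`,
no finite flat group schemes in the tree). No uniqueness is claimed.
[cite: RibetStein2008, Appendix (K. Buzzard), Thm. 6.1 (pp. 81–82)]
[cite: Buzzard2000LevelLoweringModTwo, Lemma 2.3 (p. 101)]
[cite: Edixhoven1992, Thm. 9.2 (2), (3) and (9.2.1)]
[cite: LingOesterle1991, §4.2 and Prop. 6]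
[cite: Vatsal2005, §1 (p. 281)]
[cite: DarmonDiamondTaylor1995, §1.5 (p. 36), Thm. 1.29 (p. 37), proof of Thm. 3.1(a) (p. 86)]
[cite: Conrad2001ShimuraConstruction, §5.5.1 and Thm. 5.12]
[cite: DiamondShurman2005, §5.2 and §6.2] -/
def nonempty_modularJacobianGammaOneCover : Prop :=
  ∀ (N : ℕ) [NeZero N] (ι : AlgebraicClosure ℚ →+* ℂ),
    ∃ (M₁ : Type) (_ : AddCommGroup M₁) (_ : Module (heckeRing1 N 2) M₁),
      Nonempty (ModularJacobianGammaOneCover N ι M₁)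

end Fact

/-! ### First consequences (proved) -/

section Consequences

variable {N : ℕ} [NeZero N] {ι : AlgebraicClosure ℚ →+* ℂ}
  {M₁ : Type} [AddCommGroup M₁] [Module (heckeRing1 N 2) M₁]

namespace ModularJacobianGammaOneCover

variable (C : ModularJacobianGammaOneCover N ι M₁)

/-- **The Shimura subgroup is `Γ_ℚ`-stable**: if `π^* x = 0` then `π^* (σ x) = 0` ("Since `π^*` is a
`ℚ`-rational map, the subgroup `V` is stable under the action of `Gal(ℚ̄/ℚ)`", Vatsal 2005 §1).
[cite: Vatsal2005, §1 (p. 281)] -/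
theorem pullback_galAct_eq_zero (σ : Field.absoluteGaloisGroup ℚ) {x : J0.tors N}
    (hx : C.pullback x = 0) : C.pullback (C.galAct σ x) = 0 := by
  rw [C.pullback_galAct, hx, map_zero]

/-- `π^*` intertwines `T_p` on `J₀(N)` and on `J₁(N)` (from `pullback_smul` and `restrictHecke_T`).
[cite: DiamondShurman2005, §5.2 and §6.2] -/
theorem pullback_T_smul (q : Nat.Primes) (x : J0.tors N) :
    C.pullback (HeckeRing0.T N 2 (q : ℕ) q.2 • x) = heckeRing1.T N 2 q • C.pullback x := by
  rw [← restrictHecke_T N 2 q, C.pullback_smul]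

/-- The diamond operators act trivially on the image of `π^*` (from `pullback_smul` and
`restrictHecke_diamond`). [cite: DiamondShurman2005, §5.2] -/
theorem diamond_smul_pullback (d : ZMod N) (x : J0.tors N) :
    heckeRing1.diamond N 2 d • C.pullback x = C.pullback x := by
  rw [← C.pullback_smul, restrictHecke_diamond, one_smul]

end ModularJacobianGammaOneCover

/-- **The cover fact implies the Eichler–Shimura fact** `nonempty_modularJacobianGaloisData_eichlerShimura`
(its clause is the field `galAct_eichlerShimura` of the cover's underlying Galois datum).
[cite: DarmonDiamondTaylor1995, Thm. 1.29 (p. 37) with the proof of Thm. 3.1(a) (p. 86)] -/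
theorem nonempty_modularJacobianGaloisData_eichlerShimura_of_gammaOneCover
    (h : nonempty_modularJacobianGammaOneCover) :
    nonempty_modularJacobianGaloisData_eichlerShimura := by
  intro N _ ι
  obtain ⟨M₁, _, _, ⟨C⟩⟩ := h N ι
  exact ⟨C.toModularJacobianGaloisData, C.galAct_eichlerShimura⟩

/-- **The cover fact implies the bare existence fact** `nonempty_modularJacobianGaloisData`
(forget the cover). [cite: DarmonDiamondTaylor1995, §1.5 (p. 34–36)] -/
theorem nonempty_modularJacobianGaloisData_of_gammaOneCover
    (h : nonempty_modularJacobianGammaOneCover) : nonempty_modularJacobianGaloisData := by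
  intro N _ ι
  obtain ⟨M₁, _, _, ⟨C⟩⟩ := h N ι
  exact ⟨C.toModularJacobianGaloisData⟩

end Consequences

end Literature.NumberTheory.EllipticCurves.ModularForms

end
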